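import Mathlib.RingTheory.Valuation.Discrete.Basic
import Literature.NumberTheory.EllipticCurves.WeilPairingDivisors
import Literature.NumberTheory.EllipticCurves.IsogenyCompProofs
import Literature.NumberTheory.EllipticCurves.IsogenyGeomEndRingProofs
import Literature.NumberTheory.DiophantineGeometry.FunctionFieldDivisorsNegativeDegreeProofs
import Literature.NumberTheory.DiophantineGeometry.FunctionFieldDivisorsResidueMap
import HarnessLib

/-!
# Ramification of isogenies on the places of `K̄(E)`: `e_φ(P)`, `Σ_{φ P = Q} e_φ(P) = deg φ`

Topic `NumberTheory/EllipticCurves` (trunk T-ELLARITH). Part of the decomposition of the named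
fact `WeierstrassCurve.Isogeny.det_tateModule_map_eq_deg` (`FrobeniusEndomorphism`; Silverman,
*AEC*, 2nd ed., Prop. III.8.6, `det(φ_ℓ) = deg φ`) through the Weil pairing with its adjoint
property (`exists_weilPairing_adjoint`, `WeilPairingAdjoint`): the construction of `e_m` and the
proof of Prop. III.8.2 (`e_m(φ S, T) = e_m(S, φ̂ T)`) are computations with the divisors of
pulled-back functions `div(f ∘ [m])`, `div(f ∘ φ)`, which need the ramification theory of an
isogeny `φ : E → E'` of elliptic curves over `K` (everything read over `K̄ = AlgebraicClosure K`),
Silverman, *AEC*, II.§2: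

* **`v_P ∘ φ^* = v_{φP}^{e_φ(P)}` at every point** (`Isogeny.placeVal_pullbackHom`, with
  `e_φ(P) = Isogeny.ramificationIndex φ P ≥ 1`; the tree's `WeilPairingDivisors` has this at the
  points of agreement of a rational representation, and it is moved to every `P` by translations:
  `τ_S^* ∘ φ^* = φ^* ∘ τ_{φ S}^*`, `Isogeny.transAlgHom_comp_pullbackHom`), hence
  `ord_P(φ^* u) = e_φ(P) · ord_{φP}(u)` (`Isogeny.ordAt_pullbackHom`, *AEC* Ex. 2.2);
* **Prop. II.2.6(a): `Σ_{P ∈ φ⁻¹(Q)} e_φ(P) = deg φ`** for every `Q` (`Isogeny.sum_ramificationIndex_eq_deg`),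
  by counting the zeros of `φ^*(w_Q)` for the test function `w_Q = 1/x' ∘ τ_{-Q}` (a double zero at
  `Q` only) with the point-indexed form of Stichtenoth's Thm. 1.4.11 (`sum_ord_eq_finrank`:
  a non-constant `z` has `[K̄(E) : K̄(z)]` zeros) and the tower
  `[K̄(E) : K̄(φ^* w)] = deg φ · [K̄(E') : K̄(w)]` (`Isogeny.finrank_adjoin_pullbackHom`);
* consequences: `e_φ` is
  constant (`Isogeny.ramificationIndex_eq_ramIdx`, via `e_φ(P + T) = e_φ(P)` for `T ∈ ker φ` and
  II.2.6(a) on two fibres) with **`e_φ · #ker φ = deg φ`** (`Isogeny.ramIdx_mul_card_ker`, the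
  ramification half of Thm. III.4.10(a)); **`[m]` is unramified for `m ≠ 0` in `K`**
  (`Isogeny.ramIdx_zsmul`, from `#E[m] = m² = deg [m]` of `IsogenyMulProofs`/`IsogenyFactorProofs`),
  so `ord_P(f ∘ [m]) = ord_{mP}(f)` (`Isogeny.ordAt_pullbackHom_zsmul`, the identity
  `div(f ∘ [m]) = [m]^* div(f)` of *AEC* III.§8, PDF p. 88; the tree's `WeilPairingDivisors` proves
  the same identity for `ord` independently, by a norm argument, as `ord_pullbackHom_zsmul`).

## Relation to the tree

Built on `WeilPairingDivisors` (places `W.place P` versus the point-indexed valuations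
`placeValuation` of `WeierstrassPlaces`, `placeValuation_transAlgHom`, `exists_ord_eq`,
`exists_eq_smul_of_ord_eq`, `Isogeny.exists_placeValuation_pullbackHom_eq_pow`), on
`IsogenyDegreeKernelProofs` (`Isogeny.pullbackHom`, `comap_pullbackHom_place`, `place_surjective`)
and on the `PlaceOver` API of `DiophantineGeometry` (`sum_ord_mul_degree_eq_finrank`). New here are
only: the abbreviations `W.placeVal P` / `W.ordAt P u` (the tree's `placeValuation` / `ord` for
`E / K̄` with the point typed as `P : W.geomPoints`, so that the group law can be used in the point
argument), the readings of `PlaceOver.ord` / `degree` in concrete terms (`ord_place`,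
`degree_place`, `sum_ord_eq_finrank`), and the
ramification theory listed above (`Isogeny.ramificationIndex`, `Isogeny.ramIdx` are the only
definitions). Nothing else is restated from `WeilPairingDivisors` (`Isogeny.ordAt_pullbackHom_zsmul`
is its `ord_pullbackHom_zsmul` in the `ordAt` normal form, obtained here as the case `e_{[m]} = 1`).

## References

* [SilvermanAEC2009] J. H. Silverman, *The Arithmetic of Elliptic Curves*, 2nd ed., GTM 106,
  Springer 2009: II.§2 (`e_φ(P)`, Prop. II.2.6(a), Thm. II.2.3, Ex. 2.2), Thm. III.4.10(a),
  Cor. III.5.4, III.§8 (PDF p. 88).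
* [Stichtenoth2009] H. Stichtenoth, *Algebraic Function Fields and Codes*, 2nd ed., GTM 254,
  Springer 2009, Thm. 1.4.11 (the tree's `sum_ord_mul_degree_eq_finrank`).

## Design

`noncomputable section`, `open scoped Classical`, one universe `u`; dot-notation extensions in
`namespace WeierstrassCurve` / `WeierstrassCurve.Isogeny` as in the sibling files. Valuations are
compared as functions `K̄(E) → ℤᵐ⁰` (`Valuation.comap`), so that `ord` transports by `rfl`.
-/

noncomputable section

open scoped Classical WithZero nonZeroDivisors
open scoped Polynomial.Bivariate
open Polynomial IsDedekindDomain WithZero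

universe u



/-! ## `ord` of a place read off an equivalent normalised valuation; degree one over `k̄` -/
namespace Literature.NumberTheory.EllipticCurves.AlgFunctionField
section PlaceOver
open Literature.NumberTheory.DiophantineGeometry.AlgFunctionField (PlaceOver)
open Literature.NumberTheory.DiophantineGeometry.AlgFunctionField.PlaceOver

variable {K : Type u} {F : Type*} [Field K] [Field F] [Algebra K F]

/-- **`ord_P` read off an equivalent normalised valuation**: if `u : F → ℤᵐ⁰` is equivalent to
`v_P` and takes the value `exp (-1)`, then `ord_P z = -log (u z)` for `z ≠ 0`. [folklore] -/
theorem _root_.Literature.NumberTheory.DiophantineGeometry.AlgFunctionField.PlaceOver.ord_eq_neg_log_of_isEquiv (P : PlaceOver K F) {u : Valuation F ℤᵐ⁰}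
    (hu : u.IsEquiv P.valuation) (hex : ∃ t : F, u t = exp (-1)) {z : F} (hz : z ≠ 0) :
    P.ord z = -log (u z) := by
  have huz : u z ≠ 0 := (Valuation.ne_zero_iff u).mpr hz
  have key : ∀ n : ℤ, u z ≤ exp n ↔ -n ≤ P.ord z := fun n ↦ by
    rw [← P.valuation_le_iff_of_isEquiv hu hex z n, P.valuation_le_zpow_iff_le_ord hz]
  set m := log (u z) with hm
  have hum : u z = exp m := (exp_log huz).symm
  have h1 : -m ≤ P.ord z := (key m).mp hum.le
  have h2 : ¬ (-(m - 1) ≤ P.ord z) := fun h ↦ by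
    have := (key (m - 1)).mpr h
    rw [hum, exp_le_exp] at this
    omega
  omega

/-- `ord_P` at the finite place of a height-one prime `𝔭` of a Dedekind domain `R` with
`Frac R = F` is `-log` of Mathlib's `𝔭`-adic valuation. [folklore] -/
theorem _root_.Literature.NumberTheory.DiophantineGeometry.AlgFunctionField.PlaceOver.ord_ofPrime_eq_neg_log {R : Type*} [CommRing R] [IsDedekindDomain R] [Algebra R F]
    [IsFractionRing R F] [Algebra K R] [IsScalarTower K R F]
    (𝔭 : HeightOneSpectrum R) {z : F} (hz : z ≠ 0) :
    (PlaceOver.ofPrime K F 𝔭).ord z = -log (𝔭.valuation F z) :=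
  (PlaceOver.ofPrime K F 𝔭).ord_eq_neg_log_of_isEquiv
    (Valuation.isEquiv_valuation_valuationSubring _) (𝔭.valuation_exists_uniformizer F) hz

/-- **Over an algebraically closed constant field every place (with finite-dimensional residue
field) has degree one**: the residue field is a finite extension of `K = K̄`, hence `K` itself.
[folklore] -/
theorem _root_.Literature.NumberTheory.DiophantineGeometry.AlgFunctionField.PlaceOver.degree_eq_one_of_isAlgClosed [IsAlgClosed K] (v : PlaceOver K F)
    [FiniteDimensional K v.residueField] : v.degree = 1 := by
  have hbij := IsAlgClosed.algebraMap_bijective_of_isIntegral (k := K) (K := v.residueField)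
  rw [PlaceOver.degree]
  have e : K ≃ₗ[K] v.residueField :=
    LinearEquiv.ofBijective (Algebra.linearMap K v.residueField) hbij
  rw [← e.finrank_eq, Module.finrank_self]

end PlaceOver
end Literature.NumberTheory.EllipticCurves.AlgFunctionField

namespace Literature.NumberTheory.EllipticCurves.WeierstrassPlaceAtInfinity

variable {K : Type u} [Field K] (W : WeierstrassCurve.Affine K)

/-- `ord_∞ z = -log |z|_∞` at the place at infinity of `K(W)`. [folklore] -/
theorem ord_infPlace_eq_neg_log {z : W.FunctionField} (hz : z ≠ 0) :
    (DiophantineGeometry.WeierstrassPlaceAtInfinity.infPlace W).ord z = -log (DiophantineGeometry.WeierstrassPlaceAtInfinity.infValuationF W z) :=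
  (DiophantineGeometry.WeierstrassPlaceAtInfinity.infPlace W).ord_eq_neg_log_of_isEquiv (Valuation.isEquiv_valuation_valuationSubring _)
    (DiophantineGeometry.WeierstrassPlaceAtInfinity.exists_infValuationF_eq_exp_neg_one W) hz

end Literature.NumberTheory.EllipticCurves.WeierstrassPlaceAtInfinity


/-! ## The valuations `v_P` of `K̄(E)` and the number of zeros of a function -/
namespace WeierstrassCurve

open Literature.NumberTheory.DiophantineGeometry Literature.NumberTheory.EllipticCurves.WeierstrassFunctionField Literature.NumberTheory.DiophantineGeometry.WeierstrassPlaceAtInfinity Literature.NumberTheory.EllipticCurves.WeierstrassPlaceAtInfinity Literature.NumberTheory.DiophantineGeometry.AlgFunctionField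

variable {K : Type u} [Field K] {W : WeierstrassCurve K} [W.IsElliptic]

variable (W) in
/-- The valuation of `K̄(E)` at the point `P ∈ E(K̄)` (the tree's point-indexed valuations of
`WeierstrassPlaces`, for `E / K̄`). [folklore] -/
abbrev placeVal (P : W.geomPoints) : Valuation W.geomFunctionField ℤᵐ⁰ :=
  placeValuation (W.baseChange (AlgebraicClosure K)).toAffine P

/-- **`v_R ∘ τ_S^* = v_{R+S}`** as valuations (the tree's `placeValuation_transAlgHom` of
`WeilPairingDivisors`, Silverman, *AEC*, III.3.6: `τ_S` is an isomorphism). [folklore] -/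
theorem placeVal_comap_transAlgHom (R S : W.geomPoints) :
    (W.placeVal R).comap (W.transAlgHom S : W.geomFunctionField →+* W.geomFunctionField) =
      W.placeVal (R + S) :=
  Valuation.ext fun u ↦ by rw [Valuation.comap_apply]; exact placeValuation_transAlgHom S R u

/-! ### The number of zeros of a function equals its degree (Stichtenoth 1.4.11 for `K̄(E)`) -/

/-- **`ord` of the tree's place `W.place P` is the point-indexed `ord_P`.** [folklore] -/
theorem ord_place (P : W.geomPoints) {u : W.geomFunctionField} (hu : u ≠ 0) :
    (W.place P).ord u = ord (W.baseChange (AlgebraicClosure K)).toAffine P u := by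
  by_cases hP : P = 0
  · subst hP
    rw [place_zero, ord_infPlace_eq_neg_log _ hu]
    rfl
  · obtain ⟨a, b, hab, rfl⟩ := geomPoints.exists_eq_some hP
    rw [place_some, PlaceOver.ord_ofPrime_eq_neg_log _ hu, maxIdealAt_eq_pointPrime]
    rfl

/-- Every place of `K̄(E)/K̄` has degree one (`K̄` is algebraically closed). [folklore] -/
theorem degree_place (P : W.geomPoints) : (W.place P).degree = 1 :=
  PlaceOver.degree_eq_one_of_isAlgClosed _

/-- **A non-constant function has `[K̄(E) : K̄(z)]` zeros counted with multiplicity**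
(Stichtenoth Thm. 1.4.11 for `K̄(E)`, all places being points of degree one): for `z`
transcendental over `K̄` and any finite set `T` of points containing all zeros of `z`,
`Σ_{P ∈ T, ord_P z > 0} ord_P z = [K̄(E) : K̄(z)]`. Silverman, *AEC*, Prop. II.2.6(a) for the map
`z : E → ℙ¹` over the point `0`. [cite: Stichtenoth2009, Thm. 1.4.11] -/
theorem sum_ord_eq_finrank {z : W.geomFunctionField} (hz : Transcendental (AlgebraicClosure K) z)
    (T : Finset W.geomPoints)
    (hT : ∀ P : W.geomPoints, 0 < ord (W.baseChange (AlgebraicClosure K)).toAffine P z → P ∈ T) :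
    ∑ P ∈ T with 0 < ord (W.baseChange (AlgebraicClosure K)).toAffine P z,
        ord (W.baseChange (AlgebraicClosure K)).toAffine P z =
      (Module.finrank (IntermediateField.adjoin (AlgebraicClosure K) {z}) W.geomFunctionField : ℤ) := by
  have hz0 : z ≠ 0 := fun h ↦ hz (h ▸ isAlgebraic_zero)
  have key := AlgFunctionField.sum_ord_mul_degree_eq_finrank hz (T.image W.place) fun v hv ↦ by
    obtain ⟨P, rfl⟩ := place_surjective (W := W) v
    rw [ord_place P hz0] at hv
    exact Finset.mem_image_of_mem _ (hT P hv)
  rw [← key, Finset.filter_image, Finset.sum_image fun P _ Q _ h ↦ place_injective h]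
  refine (Finset.sum_congr ?_ fun P _ ↦ ?_).symm
  · congr 1
    ext P
    simp only [ord_place P hz0]
  · rw [ord_place P hz0, degree_place, Nat.cast_one, mul_one]

end WeierstrassCurve

/-! ## Orders at points and pull-backs of places along isogenies -/

namespace WeierstrassCurve

open Literature.NumberTheory.DiophantineGeometry Literature.NumberTheory.EllipticCurves.WeierstrassFunctionField Literature.NumberTheory.DiophantineGeometry.WeierstrassPlaceAtInfinity Literature.NumberTheory.EllipticCurves.WeierstrassPlaceAtInfinity Literature.NumberTheory.DiophantineGeometry.AlgFunctionField

section OrdAt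

variable {K : Type u} [Field K] {W : WeierstrassCurve K} [W.IsElliptic]

variable (W) in
/-- **`ord_P(u)`, the order of `u ∈ K̄(E)` at `P ∈ E(K̄)`** — the tree's point-indexed
`Literature.NumberTheory.EllipticCurves.WeierstrassFunctionField.ord` of `WeierstrassPlaces` for `E / K̄`, with the point typed as a
geometric point `P : W.geomPoints` (so that the group law of `geomPoints` can be used in the
point argument). Silverman, *AEC*, II.§1 (`ord_P`). [folklore] -/
abbrev ordAt (P : W.geomPoints) (u : W.geomFunctionField) : ℤ :=
  ord (W.baseChange (AlgebraicClosure K)).toAffine P u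

/-- `v_P(u) = exp (-ord_P u)` for `u ≠ 0`. [folklore] -/
theorem placeVal_eq_exp_neg_ordAt (P : W.geomPoints) {u : W.geomFunctionField} (hu : u ≠ 0) :
    W.placeVal P u = exp (-W.ordAt P u) :=
  placeValuation_eq_exp_neg_ord P hu

/-- `ord_P (u v) = ord_P u + ord_P v`. [folklore] -/
theorem ordAt_mul (P : W.geomPoints) {u v : W.geomFunctionField} (hu : u ≠ 0) (hv : v ≠ 0) :
    W.ordAt P (u * v) = W.ordAt P u + W.ordAt P v :=
  ord_mul P hu hv

/-- `ord_P u⁻¹ = -ord_P u`. [folklore] -/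
theorem ordAt_inv (P : W.geomPoints) (u : W.geomFunctionField) : W.ordAt P u⁻¹ = -W.ordAt P u :=
  ord_inv P u

/-- `ord_P (u / v) = ord_P u - ord_P v`. [folklore] -/
theorem ordAt_div (P : W.geomPoints) {u v : W.geomFunctionField} (hu : u ≠ 0) (hv : v ≠ 0) :
    W.ordAt P (u / v) = W.ordAt P u - W.ordAt P v :=
  ord_div P hu hv

/-! ### The divisor calculus on `E(K̄)`, point-typed (from `WeilPairingDivisors`) -/

/-- **A function with `ord_P ≥ 0` everywhere is constant** (Prop. II.1.2; the tree's
`exists_eq_algebraMap_of_ord_nonneg` of `WeilPairingDivisors`, point-typed).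
[cite: SilvermanAEC2009, Prop. II.1.2] -/
theorem exists_eq_algebraMap_of_ordAt_nonneg {u : W.geomFunctionField}
    (h : ∀ P, 0 ≤ W.ordAt P u) : ∃ c : AlgebraicClosure K, u = algebraMap _ W.geomFunctionField c := by
  obtain ⟨c, hc⟩ := exists_eq_algebraMap_of_ord_nonneg (W := W) h
  exact ⟨c, hc.symm⟩

/-- **Functions with the same divisor differ by a non-zero constant factor** (the tree's
`exists_eq_smul_of_ord_eq` of `WeilPairingDivisors`, as a scalar multiple).
[cite: SilvermanAEC2009, Prop. II.1.2] -/
theorem exists_eq_smul_of_ordAt_eq {u u' : W.geomFunctionField} (hu : u ≠ 0) (hu' : u' ≠ 0)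
    (h : ∀ P, W.ordAt P u = W.ordAt P u') : ∃ c : AlgebraicClosure K, c ≠ 0 ∧ u = c • u' := by
  obtain ⟨c, hc, h'⟩ := exists_eq_smul_of_ord_eq (W := W) hu' hu fun P ↦ (h P).symm
  exact ⟨c, hc, by rw [h', Algebra.smul_def]⟩

/-- `ord_P c = 0` for constants. [folklore] -/
theorem ordAt_algebraMap (P : W.geomPoints) (c : AlgebraicClosure K) :
    W.ordAt P (algebraMap _ W.geomFunctionField c) = 0 :=
  ord_algebraMap P c

/-- `ord_R(f ∘ τ_S) = ord_{R+S}(f)` (`ord_transAlgHom` of `WeilPairingDivisors`).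
[cite: SilvermanAEC2009, II.§2 and Thm. III.3.6, proof of Prop. III.8.1(b)] -/
theorem ordAt_transAlgHom (R S : W.geomPoints) (u : W.geomFunctionField) :
    W.ordAt R (W.transAlgHom S u) = W.ordAt (R + S) u :=
  ord_transAlgHom S R u

/-- `ord_R x ≥ 0` at affine points `R` (`x` is a regular function). [folklore] -/
theorem ordAt_genX_nonneg {R : W.geomPoints} (hR : R ≠ 0) : 0 ≤ W.ordAt R W.genX := by
  obtain ⟨a, b, h, rfl⟩ := geomPoints.exists_eq_some hR
  have hx0 : W.genX ≠ 0 := fun h0 ↦ transcendental_genX W (h0 ▸ isAlgebraic_zero)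
  have hv : W.placeVal (.some a b h) W.genX ≤ 1 := by
    have : W.genX = algebraMap (Affine.CoordinateRing (W.baseChange (AlgebraicClosure K)).toAffine)
        W.geomFunctionField (algebraMap (AlgebraicClosure K)[X] _ Polynomial.X) :=
      IsScalarTower.algebraMap_apply _ _ _ _
    rw [this]
    exact HeightOneSpectrum.valuation_le_one _ _
  rw [placeVal_eq_exp_neg_ordAt _ hx0, ← exp_zero, exp_le_exp, neg_nonpos] at hv
  exact hv

/-- `ord_O x = -2`. [cite: SilvermanAEC2009, Prop. III.3.1 (proof of (a))] -/
theorem ordAt_zero_genX : W.ordAt 0 W.genX = -2 :=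
  ord_zero_X

/-- **The test function `w_Q = τ_{-Q}^* (1/x)` has a single zero, at `Q`, of order `2`**:
`ord_R (τ_{-Q}^* x⁻¹) = -ord_{R-Q} x`, which is `2` for `R = Q` and `≤ 0` otherwise. [folklore] -/
theorem ordAt_testFun (Q R : W.geomPoints) :
    W.ordAt R (W.transAlgHom (-Q) W.genX⁻¹) =
      if R = Q then 2 else -W.ordAt (R - Q) W.genX := by
  rw [map_inv₀, ordAt_inv, ordAt_transAlgHom, ← sub_eq_add_neg]
  split_ifs with h
  · rw [h, sub_self, ordAt_zero_genX]; norm_num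
  · rfl

/-- The test function is transcendental over `K̄`. [folklore] -/
theorem transcendental_testFun (Q : W.geomPoints) :
    Transcendental (AlgebraicClosure K) (W.transAlgHom (-Q) W.genX⁻¹) := by
  intro h
  have h1 : IsAlgebraic (AlgebraicClosure K) W.genX⁻¹ :=
    (isAlgebraic_algHom_iff (W.transAlgHom (-Q)) (W.transAlgHom (-Q)).toRingHom.injective).mp h
  exact transcendental_genX W (IsAlgebraic.inv_iff.mp h1)

/-- Point-typed form of `sum_ord_eq_finrank`: a non-constant function has `[K̄(E) : K̄(z)]`
zeros counted with multiplicity. [cite: Stichtenoth2009, Thm. 1.4.11] -/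
theorem sum_ordAt_eq_finrank {z : W.geomFunctionField} (hz : Transcendental (AlgebraicClosure K) z)
    (T : Finset W.geomPoints) (hT : ∀ P, 0 < W.ordAt P z → P ∈ T) :
    ∑ P ∈ T with 0 < W.ordAt P z, W.ordAt P z =
      (Module.finrank (IntermediateField.adjoin (AlgebraicClosure K) {z}) W.geomFunctionField : ℤ) :=
  sum_ord_eq_finrank hz T hT

/-- `[K̄(E) : K̄(w_Q)] = 2` for the test function (its only zero is `Q`, of order `2`).
[folklore] -/
theorem finrank_adjoin_testFun (Q : W.geomPoints) :
    Module.finrank (IntermediateField.adjoin (AlgebraicClosure K) {W.transAlgHom (-Q) W.genX⁻¹})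
      W.geomFunctionField = 2 := by
  have h := sum_ordAt_eq_finrank (transcendental_testFun Q) {Q} fun R hR ↦ by
    rw [ordAt_testFun] at hR
    split_ifs at hR with hRQ
    · rw [hRQ]; exact Finset.mem_singleton_self Q
    · exfalso
      have := ordAt_genX_nonneg (W := W) (sub_ne_zero.mpr hRQ)
      omega
  rw [Finset.sum_filter, Finset.sum_singleton, ordAt_testFun, if_pos rfl, if_pos (by norm_num)] at h
  exact_mod_cast h.symm

end OrdAt

namespace Isogeny

variable {K : Type u} [Field K] {W W' : WeierstrassCurve K} [W.IsElliptic] [W'.IsElliptic]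
variable (φ : Isogeny W W')

/-! ### Values of pulled-back functions -/

omit [W'.IsElliptic] in
/-- **`(φ^* z')(P) = z'(φ P)`**: if `z' ∈ K̄(E')` has the value `c` at the affine point `φ P` and
`φ` agrees with its rational representation at `P`, then `φ^* z'` has the value `c` at `P`.
Silverman, *AEC*, II.§2 (`φ^* f = f ∘ φ`). [folklore] -/
theorem hasValueAt_pullbackHom {P : W.geomPoints}
    (hP : AgreesWithRationalMapAt W W' φ.rationalRep.P₁ φ.rationalRep.Q₁ φ.rationalRep.P₂
      φ.rationalRep.Q₂ φ P)
    (hφP : φ P ≠ 0) {z' : W'.geomFunctionField} {c : AlgebraicClosure K}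
    (hz : W'.HasValueAt z' (φ P) c) : W.HasValueAt (φ.pullbackHom z') P c := by
  obtain ⟨a, b, h, hφPe⟩ := geomPoints.exists_eq_some hφP
  obtain ⟨g, g', hg', hzg, hc⟩ := hz
  have hP0 : P ≠ 0 := (agreesWithRationalMapAt_iff.mp hP).1
  set e := Polynomial.Bivariate.equivMvPolynomial (AlgebraicClosure K)
  -- values of `φ^* g(x', y')`, `φ^* g'(x', y')`
  have hval : ∀ q : MvPolynomial (Fin 2) (AlgebraicClosure K),
      W.HasValueAt (φ.pullbackHom (W'.evalGeneric q)) P (MvPolynomial.eval (geomPoints.xy (φ P)) q) := by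
    intro q
    have h1 := φ.hasValueAt_pullbackHom_algebraMap hP h hφPe (Affine.CoordinateRing.mk _ (e.symm q))
    rw [evalAt_mk_equivMvPolynomial_symm] at h1
    rw [evalGeneric_apply, hφPe, geomPoints.xy_some]
    exact h1
  have hne : W'.evalGeneric g' ≠ 0 := by
    intro h0
    apply hg'
    rw [hφPe, geomPoints.xy_some, ← evalAt_mk_equivMvPolynomial_symm h]
    rw [evalGeneric_apply, map_eq_zero_iff _ (FaithfulSMul.algebraMap_injective _ _)] at h0
    rw [h0, map_zero]
  have hz' : z' = W'.evalGeneric g / W'.evalGeneric g' := by rw [eq_div_iff hne, hzg]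
  rw [hz', map_div₀]
  refine ((hval g).div hP0 (hval g') hg').congr rfl ?_
  rw [hc, mul_div_cancel_right₀ _ hg']

/-- **`τ_S^* ∘ φ^* = φ^* ∘ τ_{φ S}^*`**: translating and pulling back commute as the maps of
curves do (`φ ∘ τ_S = τ_{φ S} ∘ φ`, `φ` being a homomorphism). Both sides send `x'` to functions
with the value `x'(φ P + φ S)` at almost every `P`, and likewise for `y'`. Silverman, *AEC*,
III.§4 (isogenies are homomorphisms, Thm. III.4.8) with II.§2. [folklore] -/
theorem transAlgHom_comp_pullbackHom (S : W.geomPoints) :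
    (W.transAlgHom S).comp φ.pullbackHom = φ.pullbackHom.comp (W'.transAlgHom (φ S)) := by
  set r := φ.rationalRep with hr
  -- the cofinite set of good points
  set B : Set W.geomPoints := {P | ¬ AgreesWithRationalMapAt W W' r.P₁ r.Q₁ r.P₂ r.Q₂ φ P} with hB
  have hBfin : B.Finite := r.finite
  set Bad : Set W.geomPoints := B ∪ (fun Q ↦ Q - S) '' B ∪ {0, S, -S} ∪
    ({P | φ P = 0} ∪ {P | φ P = φ S} ∪ {P | φ P = -φ S}) with hBad
  have hBadfin : Bad.Finite := by
    refine (((hBfin.union (hBfin.image _)).union (by simp)).union ?_)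
    exact ((φ.finite_fibre 0).union (φ.finite_fibre _)).union (φ.finite_fibre _)
  have hgood : ∀ P ∉ Bad, P ≠ 0 ∧ P ≠ S ∧ P + S ≠ 0 ∧ φ P ≠ 0 ∧ φ P ≠ φ S ∧ φ P + φ S ≠ 0 ∧
      AgreesWithRationalMapAt W W' r.P₁ r.Q₁ r.P₂ r.Q₂ φ P ∧
      AgreesWithRationalMapAt W W' r.P₁ r.Q₁ r.P₂ r.Q₂ φ (P + S) := by
    intro P hP
    simp only [hBad, Set.mem_union, not_or] at hP
    obtain ⟨⟨⟨hPB, hPSB⟩, hP3⟩, ⟨hφ0, hφS⟩, hφnS⟩ := hP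
    simp only [hB, Set.mem_setOf_eq, not_not] at hPB hφ0 hφS hφnS
    simp only [Set.mem_insert_iff, Set.mem_singleton_iff, not_or] at hP3
    obtain ⟨hP0, hPS, hPnS⟩ := hP3
    refine ⟨hP0, hPS, fun h ↦ hPnS (add_eq_zero_iff_eq_neg.mp h), hφ0, hφS,
      fun h ↦ hφnS (add_eq_zero_iff_eq_neg.mp h), hPB, ?_⟩
    by_contra h
    exact hPSB ⟨P + S, h, add_sub_cancel_right P S⟩
  -- compare values on `x'` and `y'`
  have key : ∀ i : Fin 2, (W.transAlgHom S) (φ.pullbackHom (![W'.genX, W'.genY] i)) =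
      φ.pullbackHom (W'.transAlgHom (φ S) (![W'.genX, W'.genY] i)) := by
    intro i
    apply eq_of_infinite_setOf_hasValueAt
    refine (hBadfin.infinite_compl).mono fun P hP ↦ ?_
    obtain ⟨hP0, hPS, hPS', hφ0, hφS, hφS', hPB, hPSB⟩ := hgood P hP
    refine ⟨hP0, geomPoints.xy (φ P + φ S) i, ?_, ?_⟩
    · -- `τ_S^* (φ^* x'ᵢ)` : value of `φ^* x'ᵢ` at `P + S` is `x'ᵢ(φ (P + S))`
      refine HasValueAt.transAlgHom hP0 hPS hPS' ?_
      have hφPS : φ (P + S) ≠ 0 := by rwa [map_add]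
      have h := φ.hasValueAt_pullbackHom hPSB hφPS (hasValueAt_gen (W := W') (φ (P + S)) i)
      rwa [map_add] at h
    · -- `φ^* (τ_{φS}^* x'ᵢ)` : value at `P` is the value of `τ^* x'ᵢ` at `φ P`
      have hfun : ![W'.transAlgHom (φ S) W'.genX, W'.transAlgHom (φ S) W'.genY] i =
          W'.transAlgHom (φ S) (![W'.genX, W'.genY] i) := by
        fin_cases i <;> rfl
      have h := hasValueAt_transAlgHom_gen hφ0 hφS hφS' i
      rw [hfun] at h
      exact φ.hasValueAt_pullbackHom hPB hφ0 h
  refine algHom_ext_xy ?_ ?_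
  · exact key 0
  · exact key 1

/-- `τ_S^* (φ^* z') = φ^* (τ_{φ S}^* z')`, pointwise form of `transAlgHom_comp_pullbackHom`.
[folklore] -/
theorem transAlgHom_pullbackHom (S : W.geomPoints) (z' : W'.geomFunctionField) :
    W.transAlgHom S (φ.pullbackHom z') = φ.pullbackHom (W'.transAlgHom (φ S) z') := by
  have h := congrArg (fun f ↦ f z') (φ.transAlgHom_comp_pullbackHom S)
  simpa using h

/-! ### The ramification exponent of `φ` at a point -/

/-- **`v_P ∘ φ^* = v_{φP} ^ e` at a point of agreement**, for a positive integer `e` (the tree's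
`Isogeny.exists_placeValuation_pullbackHom_eq_pow` of `WeilPairingDivisors`, for the chosen
rational representation `φ.rationalRep`). [folklore] -/
theorem exists_comap_pullbackHom_eq_pow_of_agrees {P : W.geomPoints}
    (hP : AgreesWithRationalMapAt W W' φ.rationalRep.P₁ φ.rationalRep.Q₁ φ.rationalRep.P₂
      φ.rationalRep.Q₂ φ P) :
    ∃ e : ℕ, 0 < e ∧ ∀ u, W.placeVal P (φ.pullbackHom u) = W'.placeVal (φ P) u ^ e := by
  obtain ⟨e, he, h⟩ := φ.exists_placeValuation_pullbackHom_eq_pow φ.rationalRep hP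
  exact ⟨e, by omega, h⟩

/-- **`v_P ∘ φ^* = v_{φP} ^ e` at every point `P`** (translate `P` to a point of agreement
`P - S` and use `τ_S^* ∘ φ^* = φ^* ∘ τ_{φS}^*` with `v_R ∘ τ_S^* = v_{R+S}` on both curves).
Silverman, *AEC*, II.§2 ("Let `φ : C₁ → C₂` ... `ord_P(φ^* f) = e_φ(P) ord_{φP}(f)`",
Exercise 2.2 / the definition of `e_φ(P)`). [cite: SilvermanAEC2009, II.§2, definition of the ramification index `e_φ(P)`] -/
theorem exists_comap_pullbackHom_eq_pow (P : W.geomPoints) :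
    ∃ e : ℕ, 0 < e ∧ ∀ u, W.placeVal P (φ.pullbackHom u) = W'.placeVal (φ P) u ^ e := by
  set B : Set W.geomPoints := {P | ¬ AgreesWithRationalMapAt W W' φ.rationalRep.P₁ φ.rationalRep.Q₁
    φ.rationalRep.P₂ φ.rationalRep.Q₂ φ P} with hB
  have hfin : ((fun Q ↦ P - Q) '' B).Finite := φ.rationalRep.finite.image _
  obtain ⟨S, hS, -⟩ := geomPoints.exists_not_mem_of_finite hfin
  have hPS : AgreesWithRationalMapAt W W' φ.rationalRep.P₁ φ.rationalRep.Q₁ φ.rationalRep.P₂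
      φ.rationalRep.Q₂ φ (P - S) := by
    by_contra h
    exact hS ⟨P - S, h, sub_sub_cancel P S⟩
  obtain ⟨e, he, h⟩ := φ.exists_comap_pullbackHom_eq_pow_of_agrees hPS
  refine ⟨e, he, fun u ↦ ?_⟩
  -- `v_P (φ^* u) = v_{P-S} (τ_S^* φ^* u) = v_{P-S} (φ^* τ'_{φS}^* u) = v_{φ(P-S)} (τ' u)^e = v_{φP} u ^ e`
  have h1 : W.placeVal P (φ.pullbackHom u) = W.placeVal (P - S) (W.transAlgHom S (φ.pullbackHom u)) := by
    have := DFunLike.congr_fun (placeVal_comap_transAlgHom (P - S) S) (φ.pullbackHom u)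
    rw [Valuation.comap_apply, sub_add_cancel] at this
    exact this.symm
  have h2 : W'.placeVal (φ (P - S)) (W'.transAlgHom (φ S) u) = W'.placeVal (φ P) u := by
    have := DFunLike.congr_fun (placeVal_comap_transAlgHom (φ (P - S)) (φ S)) u
    rw [Valuation.comap_apply, ← map_add, sub_add_cancel] at this
    exact this
  rw [h1, transAlgHom_pullbackHom, h, h2]

/-- **The ramification index `e_φ(P) ≥ 1` of the isogeny `φ` at `P ∈ E(K̄)`**: the exponent with
`v_P ∘ φ^* = v_{φP}^{e_φ(P)}`, i.e. `ord_P(φ^* f) = e_φ(P) · ord_{φP}(f)`. Silverman, *AEC*, II.§2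
(definition of `e_φ(P) = ord_P(φ^* t_{φP})`). [cite: SilvermanAEC2009, II.§2, definition of `e_φ(P)`] -/
def ramificationIndex (P : W.geomPoints) : ℕ :=
  (φ.exists_comap_pullbackHom_eq_pow P).choose

/-- `e_φ(P) ≥ 1`. [folklore] -/
theorem ramificationIndex_pos (P : W.geomPoints) : 0 < φ.ramificationIndex P :=
  (φ.exists_comap_pullbackHom_eq_pow P).choose_spec.1

/-- **`v_P(φ^* u) = v_{φP}(u) ^ e_φ(P)`.** [cite: SilvermanAEC2009, II.§2, definition of `e_φ(P)`] -/
theorem placeVal_pullbackHom (P : W.geomPoints) (u : W'.geomFunctionField) :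
    W.placeVal P (φ.pullbackHom u) = W'.placeVal (φ P) u ^ φ.ramificationIndex P :=
  (φ.exists_comap_pullbackHom_eq_pow P).choose_spec.2 u

/-- **`ord_P(φ^* u) = e_φ(P) · ord_{φP}(u)`.** Silverman, *AEC*, II.§2 (and Exercise 2.2).
[cite: SilvermanAEC2009, II.§2, definition of `e_φ(P)`] -/
theorem ordAt_pullbackHom (P : W.geomPoints) (u : W'.geomFunctionField) :
    W.ordAt P (φ.pullbackHom u) = φ.ramificationIndex P * W'.ordAt (φ P) u := by
  change -log (W.placeVal P (φ.pullbackHom u)) = _ * -log (W'.placeVal (φ P) u)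
  rw [placeVal_pullbackHom, ← zpow_natCast, log_zpow]
  ring

/-- The exponent is determined by the identity `v_P ∘ φ^* = v_{φP}^e`. [folklore] -/
theorem ramificationIndex_eq_of_forall {P : W.geomPoints} {e : ℕ}
    (h : ∀ u, W.placeVal P (φ.pullbackHom u) = W'.placeVal (φ P) u ^ e) :
    φ.ramificationIndex P = e := by
  obtain ⟨u, hu⟩ := exists_placeValuation_eq_exp_neg_one (W := W') (φ P)
  have h1 := φ.placeVal_pullbackHom P u
  rw [h u, hu, ← exp_nsmul, ← exp_nsmul] at h1
  have h2 := exp_injective h1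
  simp only [smul_neg, nsmul_eq_mul, mul_one, neg_inj, Nat.cast_inj] at h2
  exact h2.symm

/-- **`e_φ` is constant on the fibres of `φ`**: `e_φ(P + T) = e_φ(P)` for `T ∈ ker φ`
(`v_{P+T} ∘ φ^* = v_P ∘ τ_T^* ∘ φ^* = v_P ∘ φ^* ∘ τ_{φT}^* = v_P ∘ φ^*`). Silverman, *AEC*,
proof of Thm. III.4.10(a) ("every element of `φ⁻¹(Q)` has the same ramification index").
[cite: SilvermanAEC2009, Thm. III.4.10(a) (proof)] -/
theorem ramificationIndex_add_of_mem_ker (P : W.geomPoints) {T : W.geomPoints} (hT : φ T = 0) :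
    φ.ramificationIndex (P + T) = φ.ramificationIndex P := by
  refine φ.ramificationIndex_eq_of_forall fun u ↦ ?_
  have h1 : W.placeVal (P + T) (φ.pullbackHom u) = W.placeVal P (W.transAlgHom T (φ.pullbackHom u)) := by
    have := DFunLike.congr_fun (placeVal_comap_transAlgHom P T) (φ.pullbackHom u)
    rw [Valuation.comap_apply] at this
    exact this.symm
  rw [h1, transAlgHom_pullbackHom, hT, transAlgHom_zero, AlgHom.id_apply, placeVal_pullbackHom,
    map_add, hT, add_zero]

/-! ### Degrees: `[K̄(E) : K̄(φ^* w)] = deg φ · [K̄(E') : K̄(w)]` -/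

omit [W'.IsElliptic] in
/-- `φ^*` preserves transcendence over `K̄` (it is injective). [folklore] -/
theorem transcendental_pullbackHom {w : W'.geomFunctionField} (hw : Transcendental (AlgebraicClosure K) w) :
    Transcendental (AlgebraicClosure K) (φ.pullbackHom w) := fun h ↦
  hw ((isAlgebraic_algHom_iff φ.pullbackHom φ.pullbackHom.toRingHom.injective).mp h)

omit [W'.IsElliptic] in
/-- Transport along `φ^* : K̄(E') ≅ φ^* K̄(E')`: `[φ^* K̄(E') : K̄(φ^* w)] = [K̄(E') : K̄(w)]`.
[folklore] -/
theorem finrank_adjoin_extendScalars (w : W'.geomFunctionField)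
    (hle : IntermediateField.adjoin (AlgebraicClosure K) {φ.pullbackHom w} ≤ φ.pullbackField) :
    Module.finrank (IntermediateField.adjoin (AlgebraicClosure K) {φ.pullbackHom w})
        (IntermediateField.extendScalars hle) =
      Module.finrank (IntermediateField.adjoin (AlgebraicClosure K) {w}) W'.geomFunctionField := by
  symm
  -- the ring isomorphism `K̄(E') ≃ φ^* K̄(E')`
  have hmemL₁ : ∀ z : W'.geomFunctionField, φ.pullbackHom z ∈ IntermediateField.extendScalars hle :=
    fun z ↦ φ.pullbackHom_mem z
  let j₀ : W'.geomFunctionField →+* IntermediateField.extendScalars hle :=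
    (φ.pullbackHom : W'.geomFunctionField →+* W.geomFunctionField).codRestrict
      (IntermediateField.extendScalars hle).toSubring hmemL₁
  have hj₀ : Function.Bijective j₀ := by
    refine ⟨fun a b h ↦ φ.pullbackHom.toRingHom.injective (congrArg Subtype.val h), fun z ↦ ?_⟩
    obtain ⟨z', hz'⟩ := (φ.mem_pullbackField_iff z.1).mp z.2
    exact ⟨z', Subtype.ext hz'⟩
  -- the ring isomorphism `K̄(w) ≃ K̄(φ^* w)`
  have hmap : (IntermediateField.adjoin (AlgebraicClosure K) {w}).map φ.pullbackHom =
      IntermediateField.adjoin (AlgebraicClosure K) {φ.pullbackHom w} := by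
    rw [IntermediateField.adjoin_map, Set.image_singleton]
  have hmemL₀ : ∀ z : IntermediateField.adjoin (AlgebraicClosure K) {w},
      φ.pullbackHom z ∈ IntermediateField.adjoin (AlgebraicClosure K) {φ.pullbackHom w} := by
    intro z
    rw [← hmap]
    exact ⟨z, z.2, rfl⟩
  let i₀ : IntermediateField.adjoin (AlgebraicClosure K) {w} →+*
      IntermediateField.adjoin (AlgebraicClosure K) {φ.pullbackHom w} :=
    ((φ.pullbackHom : W'.geomFunctionField →+* W.geomFunctionField).comp
      (IntermediateField.adjoin (AlgebraicClosure K) {w}).toSubring.subtype).codRestrict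
        (IntermediateField.adjoin (AlgebraicClosure K) {φ.pullbackHom w}).toSubring hmemL₀
  have hi₀ : Function.Bijective i₀ := by
    refine ⟨fun a b h ↦ Subtype.ext (φ.pullbackHom.toRingHom.injective (congrArg Subtype.val h)),
      fun z ↦ ?_⟩
    have hz : (z : W.geomFunctionField) ∈ (IntermediateField.adjoin (AlgebraicClosure K) {w}).map
        φ.pullbackHom := by
      rw [hmap]; exact z.2
    obtain ⟨z', hz', hz'e⟩ := hz
    exact ⟨⟨z', hz'⟩, Subtype.ext hz'e⟩
  refine Algebra.finrank_eq_of_equiv_equiv (RingEquiv.ofBijective i₀ hi₀) (RingEquiv.ofBijective j₀ hj₀) ?_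
  ext z
  rfl

omit [W'.IsElliptic] in
/-- **The tower `K̄(φ^* w) ⊆ φ^* K̄(E') ⊆ K̄(E)`: `[K̄(E) : K̄(φ^* w)] = deg φ · [K̄(E') : K̄(w)]`**
(`φ^* : K̄(E') ≅ φ^* K̄(E')` carries `K̄(w)` onto `K̄(φ^* w)`, and `deg φ = [K̄(E) : φ^* K̄(E')]`).
Silverman, *AEC*, II.§2 (`deg φ = [K(C₁) : φ^* K(C₂)]`; multiplicativity of degrees in towers).
[folklore] -/
theorem finrank_adjoin_pullbackHom (w : W'.geomFunctionField) :
    Module.finrank (IntermediateField.adjoin (AlgebraicClosure K) {φ.pullbackHom w}) W.geomFunctionField =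
      φ.deg * Module.finrank (IntermediateField.adjoin (AlgebraicClosure K) {w}) W'.geomFunctionField := by
  have hle : IntermediateField.adjoin (AlgebraicClosure K) {φ.pullbackHom w} ≤ φ.pullbackField := by
    rw [IntermediateField.adjoin_simple_le_iff]
    exact φ.pullbackHom_mem w
  have htower := Module.finrank_mul_finrank (IntermediateField.adjoin (AlgebraicClosure K) {φ.pullbackHom w})
    (IntermediateField.extendScalars hle) W.geomFunctionField
  have hdeg : Module.finrank (IntermediateField.extendScalars hle) W.geomFunctionField = φ.deg := rfl
  rw [← htower, hdeg, mul_comm, φ.finrank_adjoin_extendScalars w hle]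

/-! ### `Σ_{P ∈ φ⁻¹(Q)} e_φ(P) = deg φ` (Silverman, *AEC*, Prop. II.2.6(a)) -/

/-- **Silverman, *AEC*, Prop. II.2.6(a) for an isogeny: `Σ_{P ∈ φ⁻¹(Q)} e_φ(P) = deg φ` for every
`Q ∈ E'(K̄)`.** Count the zeros of `φ^* w_Q` for the test function `w_Q = τ_{-Q}^*(1/x')`
(only zero: `Q`, of order `2`): they are the points of `φ⁻¹(Q)`, with orders `2 e_φ(P)`
(`ord_pullbackHom`), and their number with multiplicity is
`[K̄(E) : K̄(φ^* w_Q)] = deg φ · [K̄(E') : K̄(w_Q)] = 2 deg φ`.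
[cite: SilvermanAEC2009, Prop. II.2.6(a)] -/
theorem sum_ramificationIndex_eq_deg (Q : W'.geomPoints) :
    ∑ P ∈ (φ.finite_fibre Q).toFinset, φ.ramificationIndex P = φ.deg := by
  have hordz : ∀ P, W.ordAt P (φ.pullbackHom (W'.transAlgHom (-Q) W'.genX⁻¹)) =
      if φ P = Q then 2 * (φ.ramificationIndex P : ℤ) else
        -(φ.ramificationIndex P : ℤ) * W'.ordAt (φ P - Q) W'.genX := by
    intro P
    rw [ordAt_pullbackHom, ordAt_testFun]
    split_ifs <;> ring
  have hpos : ∀ P, 0 < W.ordAt P (φ.pullbackHom (W'.transAlgHom (-Q) W'.genX⁻¹)) ↔ φ P = Q := by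
    intro P
    rw [hordz]
    split_ifs with h
    · simp only [h, iff_true]
      have := φ.ramificationIndex_pos P
      positivity
    · simp only [h, iff_false, not_lt]
      have h1 := ordAt_genX_nonneg (W := W') (sub_ne_zero.mpr h)
      have h2 := φ.ramificationIndex_pos P
      nlinarith
  have hsum := sum_ordAt_eq_finrank (φ.transcendental_pullbackHom (transcendental_testFun Q))
    (φ.finite_fibre Q).toFinset fun P hP ↦ by
      rw [Set.Finite.mem_toFinset, Set.mem_setOf_eq]
      exact (hpos P).mp hP
  rw [finrank_adjoin_pullbackHom, finrank_adjoin_testFun] at hsum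
  have hfilter : ((φ.finite_fibre Q).toFinset.filter fun P ↦
      0 < W.ordAt P (φ.pullbackHom (W'.transAlgHom (-Q) W'.genX⁻¹))) = (φ.finite_fibre Q).toFinset := by
    refine Finset.filter_true_of_mem fun P hP ↦ ?_
    rw [Set.Finite.mem_toFinset, Set.mem_setOf_eq] at hP
    exact (hpos P).mpr hP
  rw [hfilter] at hsum
  have hterm : ∀ P ∈ (φ.finite_fibre Q).toFinset,
      W.ordAt P (φ.pullbackHom (W'.transAlgHom (-Q) W'.genX⁻¹)) = 2 * (φ.ramificationIndex P : ℤ) := by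
    intro P hP
    rw [Set.Finite.mem_toFinset, Set.mem_setOf_eq] at hP
    rw [hordz, if_pos hP]
  rw [Finset.sum_congr rfl hterm, ← Finset.mul_sum] at hsum
  push_cast at hsum
  have : (∑ P ∈ (φ.finite_fibre Q).toFinset, (φ.ramificationIndex P : ℤ)) = (φ.deg : ℤ) := by linarith
  exact_mod_cast this

omit [W.IsElliptic] [W'.IsElliptic] in
/-- The fibre of `φ` through `P` is the coset `P + ker φ`. [folklore] -/
theorem toFinset_fibre_eq_image (P : W.geomPoints) :
    (φ.finite_fibre (φ P)).toFinset =
      (φ.finite_ker.toFinset).image fun T ↦ P + T := by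
  ext P'
  simp only [Set.Finite.mem_toFinset, Set.mem_setOf_eq, Finset.mem_image, SetLike.mem_coe,
    AddMonoidHom.mem_ker, coe_toAddMonoidHom]
  constructor
  · intro h
    refine ⟨P' - P, by rw [map_sub, h, sub_self], by abel⟩
  · rintro ⟨T, hT, rfl⟩
    rw [map_add, hT, add_zero]

/-- **The ramification index is the same at every point: `e_φ(P) · #ker φ = deg φ`** (so
`e_φ(P) = deg φ / deg_s φ = deg_i φ`; Silverman, *AEC*, Thm. III.4.10(a): "for all `P`,
`e_φ(P) = deg_i φ`", here through `#ker φ = deg_s φ` of the same theorem). The fibre through `P` is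
`P + ker φ`, on which `e_φ` is constant (`ramificationIndex_add_of_mem_ker`) with sum `deg φ`
(`sum_ramificationIndex_eq_deg`). [cite: SilvermanAEC2009, Thm. III.4.10(a)] -/
theorem ramificationIndex_mul_card_ker (P : W.geomPoints) :
    φ.ramificationIndex P * Nat.card φ.toAddMonoidHom.ker = φ.deg := by
  have h := φ.sum_ramificationIndex_eq_deg (φ P)
  rw [toFinset_fibre_eq_image, Finset.sum_image (fun T _ T' _ h ↦ add_left_cancel h)] at h
  rw [Finset.sum_congr rfl (fun T hT ↦ φ.ramificationIndex_add_of_mem_ker P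
    (by simpa [Set.Finite.mem_toFinset] using hT)), Finset.sum_const, smul_eq_mul, mul_comm] at h
  rw [← h]
  congr 1
  change Nat.card (φ.toAddMonoidHom.ker : Set W.geomPoints) = _
  rw [Nat.card_coe_set_eq, Set.ncard_eq_toFinset_card _ φ.finite_ker]

/-- **`e_φ(P) = e_φ(P')` for all points `P, P'`.** [cite: SilvermanAEC2009, Thm. III.4.10(a)] -/
theorem ramificationIndex_eq (P P' : W.geomPoints) : φ.ramificationIndex P = φ.ramificationIndex P' := by
  have h := (φ.ramificationIndex_mul_card_ker P).trans (φ.ramificationIndex_mul_card_ker P').symm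
  exact Nat.eq_of_mul_eq_mul_right (Nat.card_pos (α := φ.toAddMonoidHom.ker)) h

/-- **The (constant) ramification index `e_φ = deg_i φ` of the isogeny `φ`**, defined as
`e_φ(O)`. Silverman, *AEC*, Thm. III.4.10(a) (`e_φ(P) = deg_i φ` for all `P`).
[cite: SilvermanAEC2009, Thm. III.4.10(a)] -/
def ramIdx : ℕ := φ.ramificationIndex 0

/-- `e_φ(P) = e_φ`. [cite: SilvermanAEC2009, Thm. III.4.10(a)] -/
theorem ramificationIndex_eq_ramIdx (P : W.geomPoints) : φ.ramificationIndex P = φ.ramIdx :=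
  φ.ramificationIndex_eq P 0

/-- `e_φ ≥ 1`. [folklore] -/
theorem ramIdx_pos : 0 < φ.ramIdx := φ.ramificationIndex_pos 0

/-- **`e_φ · #ker φ = deg φ`** (`deg_i φ · deg_s φ = deg φ`, with Thm. III.4.10(a)).
[cite: SilvermanAEC2009, Thm. III.4.10(a)] -/
theorem ramIdx_mul_card_ker : φ.ramIdx * Nat.card φ.toAddMonoidHom.ker = φ.deg :=
  φ.ramificationIndex_mul_card_ker 0

/-- **`ord_P(φ^* u) = e_φ · ord_{φP}(u)` with the constant `e_φ = deg φ / #ker φ`** — the formula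
`div(φ^* f) = Σ_P e_φ(P) ord_{φP}(f) (P)` for the pull-back of divisors (Silverman, *AEC*,
II.§3, definition of `φ^*` on divisors and Prop. II.3.6(b): `div(φ^* f) = φ^*(div f)`, with
III.4.10(a)). [cite: SilvermanAEC2009, II.§2–3 (`e_φ`, `φ^*` on divisors) and Thm. III.4.10(a)] -/
theorem ordAt_pullbackHom_eq (P : W.geomPoints) (u : W'.geomFunctionField) :
    W.ordAt P (φ.pullbackHom u) = φ.ramIdx * W'.ordAt (φ P) u := by
  rw [ordAt_pullbackHom, ramificationIndex_eq_ramIdx]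

end Isogeny

/-! ### Pull-backs along `[m]` -/

namespace Isogeny

variable {K : Type u} [Field K] {W : WeierstrassCurve K} [W.IsElliptic]

/-- **`[m]` is unramified: `e_{[m]} = 1`** for `m ≠ 0` in `K` (`e · #E[m] = deg [m]` with
`#E[m] = m² = deg [m]`, the tree's `Isogeny.degree_zsmul` and `Isogeny.deg_zsmul`). Silverman,
*AEC*, Cor. III.5.4 / III.6.4 (`[m]` is separable, unramified). [cite: SilvermanAEC2009, Cor. III.5.4] -/
theorem ramIdx_zsmul {m : ℤ} (hm : m ≠ 0) (hmK : (m : K) ≠ 0) : (Isogeny.zsmul W m hm).ramIdx = 1 := by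
  have h := (Isogeny.zsmul W m hm).ramIdx_mul_card_ker
  have hcard : Nat.card (Isogeny.zsmul W m hm).toAddMonoidHom.ker = m.natAbs ^ 2 := by
    have := Isogeny.degree_zsmul W m hmK
    exact this
  rw [hcard, Isogeny.deg_zsmul hm hmK] at h
  have hpos : 0 < m.natAbs ^ 2 := pow_pos (Int.natAbs_pos.mpr hm) 2
  have h' : (zsmul W m hm).ramIdx * m.natAbs ^ 2 = 1 * m.natAbs ^ 2 := by rw [h, one_mul]
  exact Nat.eq_of_mul_eq_mul_right hpos h'

/-- **`ord_P(f ∘ [m]) = ord_{mP}(f)`** (`m ≠ 0` in `K`): the divisor identity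
`div(f ∘ [m]) = [m]^* div(f)` with all ramification indices `1`, as used in the construction of the
Weil pairing ("`div(g) = [m]^*(T) - [m]^*(O)`", III.§8, PDF p. 88). In the `ordAt` normal form;
the same identity for `ord` is the tree's `WeierstrassCurve.ord_pullbackHom_zsmul`
(`WeilPairingDivisors`, proved there by a norm argument); here it is the case `e_{[m]} = 1` of
`ordAt_pullbackHom_eq`. [cite: SilvermanAEC2009, III.§8 (construction of `e_m`) with Cor. III.5.4] -/
theorem ordAt_pullbackHom_zsmul {m : ℤ} (hm : m ≠ 0) (hmK : (m : K) ≠ 0) (P : W.geomPoints)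
    (u : W.geomFunctionField) :
    W.ordAt P ((Isogeny.zsmul W m hm).pullbackHom u) = W.ordAt (m • P) u := by
  rw [ordAt_pullbackHom_eq, ramIdx_zsmul hm hmK, Nat.cast_one, one_mul, Isogeny.zsmul_apply]

end Isogeny

end WeierstrassCurve
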